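import Mathlib

/-!
# SoloInformed — slowly growing weights for a summable sequence; bounded derivatives of a bump

Soloist `solo-FinalStateConjecture-informed`, session 20 (2026-08-19). Second of three files; pure
real analysis used by `SoloInformedCategoryBlind`.

* `exists_slowly_growing_weights`: for a summable `aₙ ≥ 0` there are weights `bₙ ≥ 1`, `bₙ → ∞`, with
  `∑ₙ bₙᵏ aₙ < ∞` for EVERY `k : ℕ` (take `bₙ = 1 + log (1 + sₙ^{-1/2})`, `sₙ = ∑_{m ≥ n} aₘ + 2^{1-n}`;
  then `bₙᵏ ≤ k!·e·(1 + sₙ^{-1/2})` and `aₙ sₙ^{-1/2} ≤ 2 (√sₙ − √sₙ₊₁)` telescopes).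
* `bump`: a `ContDiffBump` on `ℝ` equal to `1` on `[-1, 1]` and to `0` outside `(-2, 2)`;
  `bump_iteratedDeriv_bound`: each of its derivatives is bounded.
-/

noncomputable section

set_option linter.dupNamespace false

open Set Filter Topology
open scoped ContDiff

namespace Summit.FinalStateConjecture.FinalStateConjecture.Theorems

/-! ### 3. Slowly growing weights and a bump with bounded derivatives -/

/-- **Slowly growing weights.** For a summable sequence `aₙ ≥ 0` there are weights `bₙ ≥ 1`,
`bₙ → ∞`, such that `∑ₙ bₙᵏ aₙ < ∞` for EVERY `k` (take `bₙ = 1 + log (1 + sₙ^{-1/2})` with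
`sₙ = ∑_{m ≥ n} aₘ + 2^{1-n}`: then `bₙᵏ ≤ k!·e·(1 + sₙ^{-1/2})` and `aₙ sₙ^{-1/2} ≤ 2(√sₙ − √sₙ₊₁)`
telescopes). [folklore] -/
theorem exists_slowly_growing_weights {a : ℕ → ℝ} (ha : ∀ n, 0 ≤ a n) (hs : Summable a) :
    ∃ b : ℕ → ℝ, (∀ n, 1 ≤ b n) ∧ Tendsto b atTop atTop ∧
      ∀ k : ℕ, Summable (fun n ↦ b n ^ k * a n) := by
  -- tails and the padded tails `s`
  set t : ℕ → ℝ := fun n ↦ ∑' m, a (m + n) with ht_def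
  have ht_nonneg : ∀ n, 0 ≤ t n := fun n ↦ tsum_nonneg fun m ↦ ha (m + n)
  have ht_succ : ∀ n, t n = a n + t (n + 1) := by
    intro n
    have hsum : Summable fun m ↦ a (m + n) := hs.comp_injective (add_left_injective n)
    rw [ht_def]
    dsimp only
    rw [hsum.tsum_eq_zero_add, zero_add]
    congr 1
    exact tsum_congr fun m ↦ congrArg a (by omega)
  have ht_lim : Tendsto t atTop (𝓝 0) := tendsto_sum_nat_add a
  set s : ℕ → ℝ := fun n ↦ t n + 2 * (1 / 2 : ℝ) ^ n with hs_def
  have hs_pos : ∀ n, 0 < s n := fun n ↦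
    add_pos_of_nonneg_of_pos (ht_nonneg n) (mul_pos two_pos (pow_pos (by norm_num) n))
  have hs_step : ∀ n, a n ≤ s n - s (n + 1) := by
    intro n
    have : s n - s (n + 1) = a n + (1 / 2 : ℝ) ^ n := by
      simp only [hs_def, ht_succ n, pow_succ]
      ring
    rw [this]
    linarith [pow_pos (by norm_num : (0 : ℝ) < 1 / 2) n]
  have hs_anti : ∀ n, s (n + 1) ≤ s n := fun n ↦ by linarith [hs_step n, ha n]
  have hs_lim : Tendsto s atTop (𝓝 0) := by
    have h2 : Tendsto (fun n : ℕ ↦ 2 * (1 / 2 : ℝ) ^ n) atTop (𝓝 0) := by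
      simpa using (tendsto_pow_atTop_nhds_zero_of_lt_one (by norm_num : (0 : ℝ) ≤ 1 / 2)
        (by norm_num)).const_mul (2 : ℝ)
    rw [hs_def]
    simpa using ht_lim.add h2
  -- the square roots `u n = √(s n)` and the rates `r n = 1 / u n`
  set u : ℕ → ℝ := fun n ↦ Real.sqrt (s n) with hu_def
  have hu_pos : ∀ n, 0 < u n := fun n ↦ Real.sqrt_pos.mpr (hs_pos n)
  have hu_sq : ∀ n, u n ^ 2 = s n := fun n ↦ Real.sq_sqrt (hs_pos n).le
  have hu_anti : ∀ n, u (n + 1) ≤ u n := fun n ↦ Real.sqrt_le_sqrt (hs_anti n)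
  have hu_lim : Tendsto u atTop (𝓝[>] 0) := by
    refine tendsto_nhdsWithin_iff.mpr ⟨?_, Eventually.of_forall hu_pos⟩
    simpa using hs_lim.sqrt
  set r : ℕ → ℝ := fun n ↦ (u n)⁻¹ with hr_def
  have hr_nonneg : ∀ n, 0 ≤ r n := fun n ↦ inv_nonneg.mpr (hu_pos n).le
  have hr_lim : Tendsto r atTop atTop := tendsto_inv_nhdsGT_zero.comp hu_lim
  -- `∑ r n * a n < ∞` by telescoping
  have hra_le : ∀ n, r n * a n ≤ 2 * (u n - u (n + 1)) := by
    intro n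
    have h1 : a n ≤ u n ^ 2 - u (n + 1) ^ 2 := by rw [hu_sq, hu_sq]; exact hs_step n
    rw [hr_def]
    dsimp only
    rw [inv_mul_eq_div, div_le_iff₀ (hu_pos n)]
    nlinarith [hu_pos (n + 1), hu_anti n, sq_nonneg (u n - u (n + 1))]
  have hra : Summable fun n ↦ r n * a n := by
    have htel : Summable fun n ↦ 2 * (u n - u (n + 1)) := by
      refine summable_of_sum_range_le (c := 2 * u 0) (fun n ↦ by linarith [hu_anti n]) fun n ↦ ?_
      rw [← Finset.mul_sum, Finset.sum_range_sub']
      linarith [hu_pos n, hu_pos 0]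
    exact htel.of_nonneg_of_le (fun n ↦ mul_nonneg (hr_nonneg n) (ha n)) hra_le
  -- the weights
  refine ⟨fun n ↦ 1 + Real.log (1 + r n), fun n ↦ ?_, ?_, fun k ↦ ?_⟩
  · have : 0 ≤ Real.log (1 + r n) := Real.log_nonneg (by linarith [hr_nonneg n])
    linarith
  · refine tendsto_atTop_add_const_left _ 1 (Real.tendsto_log_atTop.comp ?_)
    exact tendsto_atTop_add_const_left _ 1 hr_lim
  · have hbound : ∀ n, (1 + Real.log (1 + r n)) ^ k * a n ≤
        (k.factorial * Real.exp 1) * (a n + r n * a n) := by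
      intro n
      have hx : 0 ≤ 1 + Real.log (1 + r n) := by
        have : 0 ≤ Real.log (1 + r n) := Real.log_nonneg (by linarith [hr_nonneg n])
        linarith
      have h1 := Real.pow_div_factorial_le_exp _ hx k
      rw [Real.exp_add, Real.exp_log (by linarith [hr_nonneg n]),
        div_le_iff₀ (by positivity)] at h1
      have h2 : (1 + Real.log (1 + r n)) ^ k ≤ (k.factorial * Real.exp 1) * (1 + r n) := by
        nlinarith [h1, Real.exp_pos 1]
      have h3 := mul_le_mul_of_nonneg_right h2 (ha n)
      nlinarith [h3]
    refine ((hs.add hra).mul_left (k.factorial * Real.exp 1)).of_nonneg_of_le (fun n ↦ ?_) hbound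
    exact mul_nonneg (pow_nonneg (by
      have : 0 ≤ Real.log (1 + r n) := Real.log_nonneg (by linarith [hr_nonneg n])
      linarith) k) (ha n)

/-- A smooth bump on `ℝ`: `= 1` on `[-1, 1]`, `= 0` outside `(-2, 2)`. [folklore] -/
def bump : ContDiffBump (0 : ℝ) := ⟨1, 2, one_pos, one_lt_two⟩

/-- The bump is smooth. [folklore] -/
theorem bump_contDiff {n : ℕ∞} : ContDiff ℝ n (bump : ℝ → ℝ) := bump.contDiff

/-- The bump equals `1` on `[-1, 1]`. [folklore] -/
theorem bump_eq_one {x : ℝ} (hx : |x| ≤ 1) : (bump : ℝ → ℝ) x = 1 := by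
  refine bump.one_of_mem_closedBall ?_
  show dist x 0 ≤ (1 : ℝ)
  rwa [Real.dist_eq, sub_zero]

/-- The bump vanishes where `|x| ≥ 2`. [folklore] -/
theorem bump_eq_zero {x : ℝ} (hx : 2 ≤ |x|) : (bump : ℝ → ℝ) x = 0 := by
  refine bump.zero_of_le_dist ?_
  show (2 : ℝ) ≤ dist x 0
  rwa [Real.dist_eq, sub_zero]

/-- `|bump x| ≤ 1`. [folklore] -/
theorem abs_bump_le_one (x : ℝ) : |(bump : ℝ → ℝ) x| ≤ 1 := by
  rw [abs_of_nonneg bump.nonneg]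
  exact bump.le_one

/-- All derivatives of the bump are bounded (they are continuous with compact support). [folklore] -/
theorem bump_iteratedDeriv_bound (k : ℕ) : ∃ C, 0 ≤ C ∧ ∀ x, ‖iteratedDeriv k (bump : ℝ → ℝ) x‖ ≤ C := by
  have hcs : HasCompactSupport (iteratedDeriv k (bump : ℝ → ℝ)) := by
    induction k with
    | zero => simpa only [iteratedDeriv_zero] using bump.hasCompactSupport
    | succ k ih => rw [iteratedDeriv_succ]; exact ih.deriv
  obtain ⟨C, hC⟩ := ((bump_contDiff (n := ⊤)).continuous_iteratedDeriv k
    (mod_cast le_top)).bounded_above_of_compact_support hcs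
  exact ⟨max C 0, le_max_right _ _, fun x ↦ (hC x).trans (le_max_left _ _)⟩

end Summit.FinalStateConjecture.FinalStateConjecture.Theorems

end
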